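import Summits.ResolutionOfSingularities.ResolutionOfSingularities.Theorems.CofactorCutKernels
import Summits.ResolutionOfSingularities.ResolutionOfSingularities.Theorems.WeightDescentKernels
import Summits.ResolutionOfSingularities.ResolutionOfSingularities.Theorems.FrobeniusClosingPatchingRelPerfectDepthFlagCascadeCompanion
import Literature.AlgebraicGeometry.Resolution.PrimeDivisorIdeals
import HarnessLib

/-! # DescentMapKernels — decomp-res-lens-4 g40 «DescentMap», FILE A (§129 orders super-add; §130 the cofactor sheaf of a principal
in-locus shadow and its `FactorAt`; §131 the top order is constant; §132 near-branches lie in the loci; §133 isolated factor and the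
existential descent; §134 THE MAP `descentPort_holds : ∀ n, DescentPort n`, class-free; cone-free).  See the node header in
HOME/decomp-res-lens-4/g40/DescentMap.lean for the thesis, the honest tags and the placement. -/

set_option linter.dupNamespace false
set_option linter.unusedSectionVars false

noncomputable section

open CategoryTheory AlgebraicGeometry IsLocalRing TopologicalSpace
open Literature.AlgebraicGeometry.Resolution
open Summit.ResolutionOfSingularities.ResolutionOfSingularities.Theorems
open WeakOrderReduction ForcedTowerClasses DivergentTowerClasses MonomialTowerClasses
open HugDimensionClasses HugDimensionKernels SurfaceShadowClasses SurfaceShadowKernels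
open NearPointCut (SingularClass)
open Scheme.IdealSheafData (vanishingIdeal)
open Literature.AlgebraicGeometry.Resolution.Hironaka2005 (le_idealOrder_of_mul_le le_idealOrder_of_mul_le')

universe u

namespace Summit.ResolutionOfSingularities.ResolutionOfSingularities.Theorems.HugValuationCut

/-! ## ══ FILE A `Theorems/DescentMapKernels.lean` (§129–§134; cone-free; imports the LANDED `CofactorCutKernels`,
`WeightDescentKernels`, Literature `PrimeDivisorIdeals`) ══ -/

section OrderInequalities

/-! ## §129 (g40 · NEW · KERNEL) ORDERS SUPER-ADD ON PRODUCTS (any scheme) -/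

variable {X : Scheme.{0}}

-- [WRITER NOTE (decomp-res writer g14): the lens's folklore lemma `natCast_add_le_idealOrder_mul`
-- (`c₁ ≤ ord_y I₁ → c₂ ≤ ord_y I₂ → c₁ + c₂ ≤ ord_y (I₁ I₂)`) stood here; it is STATEMENT-IDENTICAL to the landed
-- `DepthCascade.le_idealOrder_mul_of_le` (Theorems/FrobeniusClosingPatchingRelPerfectDepthFlagCascadeCompanion.lean; gate dedup.landed at
-- dry-run) — deleted, that module imported, its four uses below cite the landed name (named arguments `a`/`b` for `c₁`/`c₂`).]

/-- **orders super-add on products**: `ord_y I₁ + ord_y I₂ ≤ ord_y (I₁ I₂)` in `ℕ∞`. [folklore] -/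
theorem add_idealOrder_le_idealOrder_mul (I₁ I₂ : X.IdealSheafData) (y : X) :
    idealOrder I₁ y + idealOrder I₂ y ≤ idealOrder (I₁ * I₂) y := by
  refine ENat.forall_natCast_le_iff_le.mp fun N hN => ?_
  rcases eq_or_ne (idealOrder I₁ y) ⊤ with h1 | h1
  · have := DepthCascade.le_idealOrder_mul_of_le I₁ I₂ y (a := N) (b := 0) (by rw [h1]; exact le_top) (by simp)
    simpa using this
  rcases eq_or_ne (idealOrder I₂ y) ⊤ with h2 | h2
  · have := DepthCascade.le_idealOrder_mul_of_le I₁ I₂ y (a := 0) (b := N) (by simp) (by rw [h2]; exact le_top)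
    simpa using this
  obtain ⟨a, ha⟩ := ENat.ne_top_iff_exists.mp h1
  obtain ⟨b, hb⟩ := ENat.ne_top_iff_exists.mp h2
  rw [← ha, ← hb] at hN
  have hN' : N ≤ a + b := by exact_mod_cast hN
  have key := DepthCascade.le_idealOrder_mul_of_le I₁ I₂ y (a := min N a) (b := N - min N a)
    (by rw [← ha]; exact_mod_cast min_le_right N a) (by rw [← hb]; exact_mod_cast (by omega : N - min N a ≤ b))
  have e : min N a + (N - min N a) = N := by omega
  rwa [e] at key

end OrderInequalities

section ShadowCofactor

/-! ## §130 (g40 · NEW · KERNEL) THE COFACTOR SHEAF OF A PRINCIPAL IN-LOCUS SHADOW AND ITS STALK FACTORIZATION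

For a hug shadow `S` (surface germ `G = S.germ` hugged from stage `m = S.m` on) the COFACTOR SHEAF is the Literature colon
`K := (I_m : G)`.  When the hug is PRINCIPAL (`G_x = (g)`) and IN-LOCUS (`I_x ≤ G_x`) at `x = x_m`: every `f ∈ I_x` is `f = r·g` with
`r ∈ (I_x : G_x) = K_x` (`stalkIdeal_colon`), so `I_x = G_x · K_x`; the orders are `ord G = ν₀` (finite: the hug) and
`ord K = n − ν₀` (orders of a product of ideals in a regular local ring ADD: `≥` by `le_idealOrder_of_mul_le'`, `≤` by
`Ideal.mul_not_le_maximalIdeal_pow`, the marked order being `n`, `tower_idealOrder_pt_eq`). -/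

variable {k : Type} [Field k]

/-- **the COFACTOR SHEAF of a hug shadow**: the colon ideal sheaf `(I_m : 𝓘(Σ)) = colon (T.D S.m).ideal S.germ` of stage `m`. -/
def HugShadow.cofactor {T : ForcedTower} (S : HugShadow T) : (T.St S.m).IdealSheafData :=
  colon (T.D S.m).ideal S.germ

/-- unfolding. [folklore] -/
theorem HugShadow.cofactor_eq {T : ForcedTower} (S : HugShadow T) : S.cofactor = colon (T.D S.m).ideal S.germ := rfl

/-- **STALK FACTORIZATION of a principal in-locus marking**: `I_x = G_x · (I : G)_x` when `G_x` is principal and `I_x ≤ G_x`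
(pure ideal algebra in the Noetherian stalk). (Sources: Matsumura1987, Thm. 14.2; CossartJannsenSaito2020, §6 p.58.) -/
theorem HugShadow.stalkIdeal_eq_mul_cofactor (T : ForcedTower) (g : T.St 0 ⟶ Spec (.of k)) (hB : IsBase (T.St 0) g)
    (S : HugShadow T) (hin : S.InLocus) (hP : S.Principal) :
    stalkIdeal (T.D S.m).ideal (T.pt S.m) = stalkIdeal S.germ (T.pt S.m) * stalkIdeal S.cofactor (T.pt S.m) := by
  haveI := (tower_isLocallyNoetherian_isRegular T g hB S.m).1
  have hK : stalkIdeal S.cofactor (T.pt S.m) =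
      Submodule.colon (stalkIdeal (T.D S.m).ideal (T.pt S.m)) (stalkIdeal S.germ (T.pt S.m) : Set _) :=
    stalkIdeal_colon _ _ _
  obtain ⟨g₀, hg₀⟩ := hP
  have hg : stalkIdeal S.germ (T.pt S.m) = Ideal.span {g₀} := by rw [hg₀, Ideal.submodule_span_eq]
  apply le_antisymm
  · intro f hf
    have hfG : f ∈ Ideal.span {g₀} := hg ▸ hin hf
    obtain ⟨r, hr⟩ := Ideal.mem_span_singleton'.mp hfG
    have hg₀G : g₀ ∈ stalkIdeal S.germ (T.pt S.m) := by rw [hg]; exact Ideal.mem_span_singleton_self g₀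
    have hrK : r ∈ stalkIdeal S.cofactor (T.pt S.m) := by
      rw [hK]
      refine Submodule.mem_colon.mpr fun s hs => ?_
      have hs' : s ∈ Ideal.span {g₀} := by rw [← hg]; exact hs
      obtain ⟨c, hc⟩ := Ideal.mem_span_singleton'.mp hs'
      rw [← hc, smul_eq_mul, show r * (c * g₀) = c * (r * g₀) by ring, hr]
      exact Ideal.mul_mem_left _ c hf
    rw [← hr]
    exact Ideal.mul_mem_mul_rev hg₀G hrK
  · refine Ideal.mul_le.mpr fun s hs r hr => ?_
    rw [hK] at hr
    have := Submodule.mem_colon.mp hr s hs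
    rwa [smul_eq_mul, mul_comm] at this

/-- **THE COFACTOR DATUM `FactorAt T m ν₀ (n − ν₀) 𝓘(Σ) (I : 𝓘(Σ))`** of a principal in-locus shadow, with `ν₀ = S.topOrder 0 ∈ [1, n]`
(orders add in the regular stalk). (Sources: Matsumura1987, Thm. 14.2; Hironaka2005, §2; Kollar2007, 3.58.) -/
theorem HugShadow.exists_factorAt_cofactor (T : ForcedTower) (g : T.St 0 ⟶ Spec (.of k)) (hB : IsBase (T.St 0) g) {n : ℕ}
    (hD : IsDatum n (T.D 0)) (S : HugShadow T) (hin : S.InLocus) (hP : S.Principal) :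
    ∃ a : ℕ, ((a : ℕ) : ℕ∞) = S.topOrder 0 ∧ 1 ≤ a ∧ a ≤ n ∧ FactorAt T S.m a (n - a) S.germ S.cofactor := by
  obtain ⟨hN, hR⟩ := tower_isLocallyNoetherian_isRegular T g hB S.m
  haveI := hN
  haveI : IsRegularLocalRing ((T.St S.m).presheaf.stalk (T.pt S.m)) := hR _
  obtain ⟨a, ha⟩ := ENat.ne_top_iff_exists.mp S.hugs.1
  have hn : idealOrder (T.D S.m).ideal (T.pt S.m) = (n : ℕ∞) := tower_idealOrder_pt_eq T g hB hD S.m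
  have hfac := S.stalkIdeal_eq_mul_cofactor T g hB hin hP
  have ha0 : ((a : ℕ) : ℕ∞) = S.topOrder 0 := ha
  have ha1 : 1 ≤ a := by
    have h := S.one_le_topOrder 0
    rw [← ha0] at h
    exact_mod_cast h
  have han : a ≤ n := by
    have h := S.topOrder_zero_le_order hin
    rw [← ha0, hn] at h
    exact_mod_cast h
  have hGK : idealOrder (S.germ * S.cofactor) (T.pt S.m) = (n : ℕ∞) := by
    rw [← idealOrder_congr_stalk (I := (T.D S.m).ideal) (by rw [stalkIdeal_mul]; exact hfac)]
    exact hn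
  have hKge : ((n - a : ℕ) : ℕ∞) ≤ idealOrder S.cofactor (T.pt S.m) :=
    le_idealOrder_of_mul_le' ‹_› (by rw [hGK]; exact_mod_cast (by omega : a + (n - a) ≤ n)) ha.ge
  have hKle : idealOrder S.cofactor (T.pt S.m) ≤ ((n - a : ℕ) : ℕ∞) := by
    by_contra hlt
    rw [not_le] at hlt
    have h1 : ((n - a + 1 : ℕ) : ℕ∞) ≤ idealOrder S.cofactor (T.pt S.m) := by
      rw [Nat.cast_add_one]
      exact ENat.coe_add_one_le_iff.mpr hlt
    have h2 := DepthCascade.le_idealOrder_mul_of_le S.germ S.cofactor (T.pt S.m) ha.le h1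
    rw [hGK] at h2
    have h3 : a + (n - a + 1) ≤ n := by exact_mod_cast h2
    omega
  exact ⟨a, ha0, ha1, han, hfac, ha.symm, le_antisymm hKle hKge⟩

end ShadowCofactor

section TopOrderConstant

/-! ## §131 (g40 · NEW · KERNEL) THE TOP ORDER IS CONSTANT ALONG A PRINCIPAL SHADOW; PURITY ⟺ `ν₀ = n`

g33's `FactorAt.principal_facIter`: for a principal factor the strict chain `strictIter` (whose orders at the marked points are the
`S.topOrder j`) and the weight-`a` controlled chain `facIter` have THE SAME STALK at every marked point; by `FactorAt.forcing` the
latter has order exactly `a` there.  So `ν_j = ν₀` for all `j`. -/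

variable {k : Type} [Field k]

/-- **`ν_j = a` for every `j`** along a principal shadow carrying a factorization of weights `(a, b)` with first factor the germ.
(Sources: Kollar2007, 3.58–3.60; Hironaka1964, Ch. III.) -/
theorem HugShadow.topOrder_eq_of_factorAt (T : ForcedTower) (g : T.St 0 ⟶ Spec (.of k)) (hB : IsBase (T.St 0) g) {n : ℕ}
    (hD : IsDatum n (T.D 0)) (S : HugShadow T) {a b : ℕ} {K : (T.St S.m).IdealSheafData}
    (hF : FactorAt T S.m a b S.germ K) (hP : S.Principal) (j : ℕ) : S.topOrder j = ((a : ℕ) : ℕ∞) := by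
  show idealOrder (strictIter T S.m S.germ j) (T.pt (S.m + j)) = a
  rw [idealOrder_congr_stalk (hF.principal_facIter T g hB hD hP j).2]
  exact (hF.forcing T g hB hD j).2.1

/-- a principal shadow whose germ is a factor of FULL weight `n` is pure. [folklore] -/
theorem HugShadow.pure_of_factorAt (T : ForcedTower) (g : T.St 0 ⟶ Spec (.of k)) (hB : IsBase (T.St 0) g) {n : ℕ}
    (hD : IsDatum n (T.D 0)) (S : HugShadow T) {b : ℕ} {K : (T.St S.m).IdealSheafData} (hF : FactorAt T S.m n b S.germ K)
    (hP : S.Principal) : S.Pure n :=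
  ⟨0, fun j _ => S.topOrder_eq_of_factorAt T g hB hD hF hP j⟩

/-- **PURITY CRITERION**: a principal in-locus shadow of a weight-`n` tower is pure iff `ν₀ = n`; equivalently it is NOT pure iff
its cofactor has positive weight `n − ν₀ ≥ 1`. [folklore] -/
theorem HugShadow.pure_iff_topOrder_zero_eq (T : ForcedTower) (g : T.St 0 ⟶ Spec (.of k)) (hB : IsBase (T.St 0) g) {n : ℕ}
    (hD : IsDatum n (T.D 0)) (S : HugShadow T) (hin : S.InLocus) (hP : S.Principal) :
    S.Pure n ↔ S.topOrder 0 = (n : ℕ∞) := by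
  obtain ⟨a, ha0, -, -, hF⟩ := S.exists_factorAt_cofactor T g hB hD hin hP
  refine ⟨fun ⟨j₀, hj₀⟩ => ?_, fun h => ⟨0, fun j _ => ?_⟩⟩
  · rw [← ha0, ← S.topOrder_eq_of_factorAt T g hB hD hF hP j₀]
    exact hj₀ j₀ le_rfl
  · rw [S.topOrder_eq_of_factorAt T g hB hD hF hP j, ha0]
    exact h

end TopOrderConstant

section BranchesInLoci

/-! ## §132 (g40 · NEW · KERNEL) NEAR-BRANCHES OF THE FACTOR CHAINS LIE IN THE TOP / TAIL LOCI

Generization (Literature `stalkIdeal_map_stalkSpecializes`: `J_η = J_x · 𝒪_η` along `η ⤳ x`) transports the marked-stalk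
identities `Σ_j,x = G_j,x` (g33) and `I_x = G_j,x · K_j,x` (forcing) to every proper generization `η` of the marked point; so a
near-branch of the weight-`ν₀` chain `G_j` lies in `Top_j = {ord Σ_j ≥ ν_j}` and a near-branch of the cofactor chain `K_j` (weight
`b = n − ν₀`) lies in `Tail_j = {ord I ≥ ord Σ_j + (n − ν_j)}` (orders super-add, §129).  Under `TopIsolated` / `TailIsolated n`
from stage `j₀` on these near-branch sets are therefore EMPTY from `j₀` on. -/

variable {k : Type} [Field k]

/-- near-branches of the germ's weight chain lie in the top locus. (Sources: StacksProject, Tag 01J7; Kollar2007, 3.58–3.60.) -/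
theorem HugShadow.brSet_subset_topLocus (T : ForcedTower) (g : T.St 0 ⟶ Spec (.of k)) (hB : IsBase (T.St 0) g) {n : ℕ}
    (hD : IsDatum n (T.D 0)) (S : HugShadow T) {a b : ℕ} {K : (T.St S.m).IdealSheafData}
    (hF : FactorAt T S.m a b S.germ K) (hP : S.Principal) (j : ℕ) :
    brSet T (S.m + j) a (facIter T S.m a S.germ j) ⊆ S.topLocus j := by
  rintro η ⟨hηx, -, hηa⟩
  have hgen : stalkIdeal (strictIter T S.m S.germ j) η = stalkIdeal (facIter T S.m a S.germ j) η := by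
    rw [← stalkIdeal_map_stalkSpecializes (strictIter T S.m S.germ j) hηx,
      ← stalkIdeal_map_stalkSpecializes (facIter T S.m a S.germ j) hηx, (hF.principal_facIter T g hB hD hP j).2]
  show S.topOrder j ≤ idealOrder (strictIter T S.m S.germ j) η
  rw [S.topOrder_eq_of_factorAt T g hB hD hF hP j, idealOrder_congr_stalk hgen]
  exact hηa

/-- near-branches of the cofactor's weight chain lie in the tail locus. (Sources: StacksProject, Tag 01J7; Matsumura1987, Thm. 14.2;
Kollar2007, 3.58–3.60.) -/
theorem HugShadow.brSet_subset_tailLocus (T : ForcedTower) (g : T.St 0 ⟶ Spec (.of k)) (hB : IsBase (T.St 0) g) {n : ℕ}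
    (hD : IsDatum n (T.D 0)) (S : HugShadow T) {a b : ℕ} {K : (T.St S.m).IdealSheafData}
    (hF : FactorAt T S.m a b S.germ K) (hP : S.Principal) (j : ℕ) :
    brSet T (S.m + j) b (facIter T S.m b K j) ⊆ S.tailLocus n j := by
  rintro η ⟨hηx, -, hηb⟩
  have hab : a + b = n := hF.add_eq T g hB hD
  have hgen : stalkIdeal (strictIter T S.m S.germ j) η = stalkIdeal (facIter T S.m a S.germ j) η := by
    rw [← stalkIdeal_map_stalkSpecializes (strictIter T S.m S.germ j) hηx,
      ← stalkIdeal_map_stalkSpecializes (facIter T S.m a S.germ j) hηx, (hF.principal_facIter T g hB hD hP j).2]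
  have hIη : stalkIdeal (T.D (S.m + j)).ideal η = stalkIdeal (facIter T S.m a S.germ j * facIter T S.m b K j) η := by
    rw [stalkIdeal_mul, ← stalkIdeal_map_stalkSpecializes (T.D (S.m + j)).ideal hηx, (hF.forcing T g hB hD j).1,
      Ideal.map_mul, stalkIdeal_map_stalkSpecializes, stalkIdeal_map_stalkSpecializes]
  have hsub : (n : ℕ∞) - ((a : ℕ) : ℕ∞) = ((b : ℕ) : ℕ∞) := by
    rw [← ENat.coe_sub, show n - a = b by omega]
  show ((n : ℕ∞) - S.topOrder j) + idealOrder (strictIter T S.m S.germ j) η ≤ idealOrder (T.D (S.m + j)).ideal η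
  rw [S.topOrder_eq_of_factorAt T g hB hD hF hP j, hsub, idealOrder_congr_stalk hgen, idealOrder_congr_stalk hIη]
  calc ((b : ℕ) : ℕ∞) + idealOrder (facIter T S.m a S.germ j) η
      = idealOrder (facIter T S.m a S.germ j) η + ((b : ℕ) : ℕ∞) := add_comm _ _
    _ ≤ idealOrder (facIter T S.m a S.germ j) η + idealOrder (facIter T S.m b K j) η := add_le_add le_rfl hηb
    _ ≤ idealOrder (facIter T S.m a S.germ j * facIter T S.m b K j) η := add_idealOrder_le_idealOrder_mul _ _ η

/-- **TOP-ISOLATED from `j₀` on ⟹ the germ's weight chain has NO near-branch from `j₀` on.** [folklore] -/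
theorem HugShadow.brSet_eq_empty_of_topIsolated (T : ForcedTower) (g : T.St 0 ⟶ Spec (.of k)) (hB : IsBase (T.St 0) g)
    {n : ℕ} (hD : IsDatum n (T.D 0)) (S : HugShadow T) {a b : ℕ} {K : (T.St S.m).IdealSheafData}
    (hF : FactorAt T S.m a b S.germ K) (hP : S.Principal) {j₀ : ℕ}
    (hI : ∀ j, j₀ ≤ j → IsIsolatedIn (S.topLocus j) (T.pt (S.m + j))) {j : ℕ} (hj : j₀ ≤ j) :
    brSet T (S.m + j) a (facIter T S.m a S.germ j) = ∅ :=
  Set.eq_empty_iff_forall_notMem.mpr fun η hη => by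
    obtain ⟨-, U, hxU, hU⟩ := hI j hj
    exact hη.2.1 (hU ⟨hη.1.mem_open U.isOpen hxU, S.brSet_subset_topLocus T g hB hD hF hP j hη⟩)

/-- **TAIL-ISOLATED from `j₀` on ⟹ the cofactor's weight chain has NO near-branch from `j₀` on.** [folklore] -/
theorem HugShadow.brSet_eq_empty_of_tailIsolated (T : ForcedTower) (g : T.St 0 ⟶ Spec (.of k)) (hB : IsBase (T.St 0) g)
    {n : ℕ} (hD : IsDatum n (T.D 0)) (S : HugShadow T) {a b : ℕ} {K : (T.St S.m).IdealSheafData}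
    (hF : FactorAt T S.m a b S.germ K) (hP : S.Principal) {j₀ : ℕ}
    (hI : ∀ j, j₀ ≤ j → IsIsolatedIn (S.tailLocus n j) (T.pt (S.m + j))) {j : ℕ} (hj : j₀ ≤ j) :
    brSet T (S.m + j) b (facIter T S.m b K j) = ∅ :=
  Set.eq_empty_iff_forall_notMem.mpr fun η hη => by
    obtain ⟨-, U, hxU, hU⟩ := hI j hj
    exact hη.2.1 (hU ⟨hη.1.mem_open U.isOpen hxU, S.brSet_subset_tailLocus T g hB hD hF hP j hη⟩)

end BranchesInLoci

section IsolatedFactorFromShadow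

/-! ## §133 (g40 · NEW · KERNEL) EVENTUALLY NO NEAR-BRANCH ⟹ AN ISOLATED FACTOR (g39's letter) ⟹ DESCENT

Re-root the factorization at stage `m + j₀` (`FactorAt.forcing`, g38 `facIter_add_heq`/`brSet_eq_of_heq`): with no near-branch the
marked point is ISOLATED in the weight locus of the chain (g38 `isIsolatedIn_of_brSet_eq_empty`), which is the support of the
companion marked chain — g39's class-general letter `IsolatedFactorTower T`.  An isolated factor of weight `w` with cofactor of
positive weight ROOTS g36's restricted re-rooted `companionTower` of weight `w < n` (the existential form of g39's descent law
`noTower_isolatedFactor_of_minimal`). -/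

variable {k : Type} [Field k]

/-- **eventually no near-branch ⟹ isolated factor.** (Sources: Kollar2007, 3.58–3.60; BierstoneGrigorievMilmanWlodarczyk2011, §3.1–3.2.) -/
theorem isolatedFactorTower_of_eventually_brSet_eq_empty (T : ForcedTower) (g : T.St 0 ⟶ Spec (.of k))
    (hB : IsBase (T.St 0) g) {n : ℕ} (hD : IsDatum n (T.D 0)) {m a b : ℕ} {H K : (T.St m).IdealSheafData}
    (hF : FactorAt T m a b H K) (ha : 1 ≤ a) (hb : 1 ≤ b) {j₀ : ℕ}
    (he : ∀ j, j₀ ≤ j → brSet T (m + j) b (facIter T m b K j) = ∅) : IsolatedFactorTower T := by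
  have hF' : FactorAt T (m + j₀) a b (facIter T m a H j₀) (facIter T m b K j₀) := hF.forcing T g hB hD j₀
  refine ⟨m + j₀, a, b, facIter T m a H j₀, facIter T m b K j₀, hF', ha, hb, fun j => ?_⟩
  have he' : brSet T (m + j₀ + j) b (facIter T (m + j₀) b (facIter T m b K j₀) j) = ∅ :=
    (brSet_eq_of_heq T b (Nat.add_assoc m j₀ j) (facIter_add_heq T m b K j₀ j)).2.2.mpr
      (he (j₀ + j) (Nat.le_add_right j₀ j))
  have hx : ((b : ℕ) : ℕ∞) ≤ idealOrder (facIter T (m + j₀) b (facIter T m b K j₀) j) (T.pt (m + j₀ + j)) :=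
    (hF'.forcing T g hB hD j).2.2.ge
  have hS : (companionMarked T (m + j₀) b (facIter T m b K j₀) j).support =
      {y | ((b : ℕ) : ℕ∞) ≤ idealOrder (facIter T (m + j₀) b (facIter T m b K j₀) j) y} :=
    Set.ext fun y => mem_support_companionMarked_iff T (m + j₀) b (facIter T m b K j₀) j y
  rw [hS]
  exact isIsolatedIn_of_brSet_eq_empty T g hB (m + j₀ + j) b _ hx he'

/-- **DESCENT FROM AN ISOLATED FACTOR (existential form of g39's descent law)**: an isolated factor of weight `b ≥ 1` with cofactor
of weight `a ≥ 1` roots a forced tower over the same field — g36's restricted re-rooted `companionTower` (`IsBase`, `IsDatum b`,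
empty boundary BY NAME) — of weight `b`, and `1 ≤ b < n = a + b`.
(Sources: Kollar2007, 3.58–3.60; BierstoneGrigorievMilmanWlodarczyk2011, §3.1–3.2; CossartJannsenSaito2020, §4 p.58.) -/
theorem descent_of_isolatedFactorTower (T : ForcedTower) (g : T.St 0 ⟶ Spec (.of k)) (hB : IsBase (T.St 0) g) {n : ℕ}
    (hD : IsDatum n (T.D 0)) (h : IsolatedFactorTower T) :
    ∃ n' : ℕ, 1 ≤ n' ∧ n' < n ∧ ∃ (T' : ForcedTower) (g' : T'.St 0 ⟶ Spec (.of k)),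
      IsBase (T'.St 0) g' ∧ IsDatum n' (T'.D 0) ∧ (T'.D 0).boundary = [] := by
  obtain ⟨m, a, b, H, K, hF, ha, hb, hI⟩ := h
  have hab : a + b = n := hF.add_eq T g hB hD
  have h0 : (towerOfCompanion T m b K hI).pt 0 ∈ companionRootOpens T m b K hI g hB :=
    pt_mem_companionRootOpens T m b K hI g hB hF.symm
  exact ⟨b, hb, by omega, companionTower T m b K hI g hB h0, (companionRootOpens T m b K hI g hB).ι ≫ toRoot T m ≫ g,
    companionTower_isBase T m b K hI g hB h0, companionTower_isDatum T m b K hI g hB h0,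
    companionTower_boundary T m b K hI g hB h0⟩

/-- **THE SHADOW LETTERS ARE THE TOWER LETTER**: a principal in-locus shadow of a weight-`n` tower which is NOT pure and one of
whose factors eventually isolates the marked points (`FactorIsolated n`) yields an ISOLATED FACTOR (g39 `IsolatedFactorTower`) — the
re-rooted germ chain of weight `ν₀` (top branch) or the re-rooted cofactor chain of weight `n − ν₀` (tail branch), both weights in
`[1, n − 1]`. (Sources: BierstoneGrigorievMilmanWlodarczyk2011, §3.1–3.2; CossartJannsenSaito2020, §6; Kollar2007, 3.58–3.60.) -/
theorem HugShadow.isolatedFactorTower_of_factorIsolated (T : ForcedTower) (g : T.St 0 ⟶ Spec (.of k))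
    (hB : IsBase (T.St 0) g) {n : ℕ} (hD : IsDatum n (T.D 0)) (S : HugShadow T) (hin : S.InLocus) (hP : S.Principal)
    (hnp : ¬ S.Pure n) (hFI : S.FactorIsolated n) : IsolatedFactorTower T := by
  obtain ⟨a, -, ha1, han, hF⟩ := S.exists_factorAt_cofactor T g hB hD hin hP
  have hlt : a < n := by
    refine lt_of_le_of_ne han fun h => hnp ⟨0, fun j _ => ?_⟩
    rw [S.topOrder_eq_of_factorAt T g hB hD hF hP j, h]
  rcases hFI with ⟨j₀, hI⟩ | ⟨j₀, hI⟩
  · exact isolatedFactorTower_of_eventually_brSet_eq_empty T g hB hD hF.symm (by omega) ha1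
      fun j hj => S.brSet_eq_empty_of_topIsolated T g hB hD hF hP hI hj
  · exact isolatedFactorTower_of_eventually_brSet_eq_empty T g hB hD hF ha1 (by omega)
      fun j hj => S.brSet_eq_empty_of_tailIsolated T g hB hD hF hP hI hj

end IsolatedFactorFromShadow

section ThePort

/-! ## §134 (g40 · NEW) THE MAP: `DescentPort n` HOLDS FOR EVERY `n` (class-free) -/

variable {k : Type} [Field k]

/-- **THE CLASS-FREE DESCENT THEOREM** (no `p`, no `CharP`, no boundary, no `SingularClass`): along a principal in-locus shadow of a
weight-`n` forced tower which is not pure and factor-isolated there is a forced tower over the same field of a weight `1 ≤ n' < n`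
(root letters `IsBase`, `IsDatum n'`, empty boundary). (Sources: BierstoneGrigorievMilmanWlodarczyk2011, §3.1–3.2; Kollar2007,
3.58–3.60; CossartJannsenSaito2020, §4 p.58, §6.) -/
theorem HugShadow.descent (T : ForcedTower) (g : T.St 0 ⟶ Spec (.of k)) (hB : IsBase (T.St 0) g) {n : ℕ}
    (hD : IsDatum n (T.D 0)) (S : HugShadow T) (hin : S.InLocus) (hP : S.Principal) (hnp : ¬ S.Pure n)
    (hFI : S.FactorIsolated n) :
    ∃ n' : ℕ, 1 ≤ n' ∧ n' < n ∧ ∃ (T' : ForcedTower) (g' : T'.St 0 ⟶ Spec (.of k)),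
      IsBase (T'.St 0) g' ∧ IsDatum n' (T'.D 0) ∧ (T'.D 0).boundary = [] :=
  descent_of_isolatedFactorTower T g hB hD (S.isolatedFactorTower_of_factorIsolated T g hB hD hin hP hnp hFI)

/-- **THE MAP — g16's COSTUME port `DescentPort n` is a theorem, for every weight `n`.** (Sources: BierstoneGrigorievMilmanWlodarczyk2011,
§3.1–3.2; Kollar2007, 3.58–3.60; CossartJannsenSaito2020, §4, §6; EncinasVillamayor2000.) -/
theorem descentPort_holds (n : ℕ) : DescentPort n :=
  fun _ _ _ _ _ T g hB hD _ _ S hin hP hnp hFI => S.descent T g hB hD hin hP hnp hFI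

/-- **the port over all weights.** [folklore] -/
theorem descentPortAll_holds : DescentPortAll := fun n _ => descentPort_holds n

/-- **at weight `1`** (g16's PROVED anchor `descentPort_one_iff` BY NAME): no singular-class tower of weight `1` carries an impure
factor-isolated principal in-locus shadow (there is no weight to descend to). [folklore] -/
theorem noTower_impureFactorIsolated_one :
    NoTower 1 fun T => SingularClass T ∧ ∃ S : HugShadow T, S.InLocus ∧ S.Principal ∧ ¬ S.Pure 1 ∧ S.FactorIsolated 1 :=
  descentPort_one_iff.mp (descentPort_holds 1)

/-- **g16's weight-descent law, now port-free**: in minimal currency no in-locus-class tower has an impure factor-isolated principal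
shadow (`factorIsolated_of_descent` BY NAME with the port discharged). [folklore] -/
theorem factorIsolatedTowersTerminate_of_minimal (n : ℕ) (hmin : MinimalAt n) : FactorIsolatedTowersTerminate n :=
  factorIsolated_of_descent (descentPort_holds n) hmin

end ThePort

end Summit.ResolutionOfSingularities.ResolutionOfSingularities.Theorems.HugValuationCut
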